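import Mathlib
import HarnessLib
import Literature.MathematicalPhysics.StatisticalMechanics.FluctuationKernelComparisonTransfer
import Literature.MathematicalPhysics.StatisticalMechanics.FluctuationKernelComparisonTraceTorusFRD
import Literature.MathematicalPhysics.StatisticalMechanics.TorusKernelReperiodisation
import Literature.MathematicalPhysics.StatisticalMechanics.RenormalisationStepFactorisation

/-!
# [ABKM19] Lemma 8.4 (`ℓ = 1`) for the step kernels of one `TorusFRD` package, VOLUME-UNIFORM per-polymer
# form: the Hilbert–Schmidt price is paid on a small torus of side `L^{N̄} ≥ 2 diam(X*⁺)` ([Buc16] Thm 4.5)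

Assembly of the localisation route to [ABKM19] Lemma 8.4 (`ℓ = 1`) on `(ℤ/L^N)^d`:

* `FluctuationKernelComparisonTransfer.tayNormLE_fluct_sub_fluct_of_sum_sq_transfer` — the comparison is
  carried out on an auxiliary torus reproducing the covariances on the support of the gauge;
* `TorusKernelReperiodisation` — the auxiliary torus `(ℤ/L^{N̄})^d`, `k+1 ≤ N̄ ≤ N`, with the re-periodised
  kernels `𝒞_{1+q,k+1} ∘ liftSite`: even, nonzero multipliers `= 𝒞̂_{1+q,k+1}(liftMode κ')` (a SUBSET of the
  big ones, same shells), zero modes equal (the far-field constant `M_{k+1}` does not depend on `q`), and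
  the covariance identity on sets of sup-diameter `≤ L^{N̄}/2` (finite range `L^{k+1}/2 ≤ L^{N̄}/2`);
* `RenormalisationStepFactorisation.fieldGauge_eq_of_eqOn_thicken` — the gauge `T_k^{X*}` sees the field
  only on `X*⁺ = X* + [−p_Φ, p_Φ]^d`;
* `TorusFRDKernelComparisonShell` + `TorusShellCount` ON THE SMALL TORUS — `h_S² ≤ 3^{d+1}(T e^{2KT}K)² L^{(N̄−k−1)d}`.

Result: **`tayNormLE_fluct_sub_fluct_local_of_torusFRD`** —
`‖fluct 𝒞_{1+q'} F − fluct 𝒞_{1+q} F‖_{k:k+1,X} ≤ b · ((r₀+1) · 8q_H · (3^{d+1} L^{(N̄−(k+1))d})^{1/2} · T e^{2KT} K) · κ^{|X|_k}`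
for EVERY `N̄` with `k+1 ≤ N̄ ≤ N` and `diam_∞(X*⁺) ≤ L^{N̄}/2` — the volume `L^{Nd}` is gone; the
resummation over polymers chooses `N̄` from the diameter of the connected `(k+1)`-polymer at hand
([ABKM19] p. 65: `(D L^{−k})^{d/2} ≤ (2L|X|_k)^{d/2}`).  Everything is proved; no named fact.

## References
* S. Buchholz, J. Funct. Anal. 275 (2018), Lemma 4.1, Thm 4.5, (4.33)–(4.37) [Buchholz2016].
* S. Adams, S. Buchholz, R. Kotecký, S. Müller, arXiv:1910.13564, Lemma 8.4 (and p. 65) [AdamsBuchholzKoteckyMuller2019].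
-/

noncomputable section

namespace Literature.MathematicalPhysics.StatisticalMechanics.GradientRG

open scoped BigOperators
open Real Set Finset MeasureTheory
open Literature.MathematicalPhysics.StatisticalMechanics.GradientFRD
  (fourierCoeff cExt cExt_of_mem IsElliptic IsUnitSymm InShell iterDiff supNorm conv ellOp isElliptic_one
    exists_inShell inShell_le re_fourierCoeff_zero_of_sum_eq_zero liftSite liftMode projSite
    fourierCoeff_comp_liftSite_of_ne_zero fourierCoeff_comp_liftSite_zero inShell_liftMode_iff liftMode_eq_zero_iff
    comp_liftSite_even comp_liftSite_projSite_sub fourierCoeff_zero)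
open Literature.MathematicalPhysics.StatisticalMechanics.TorusPolymer (IsPolymer numBlocks thicken)
open Literature.MathematicalPhysics.QuantumFieldTheory

variable {d M : ℕ} [NeZero M]

section Package

variable {L N Mord R n ñ : ℕ} {θbar lam μ δ₁ δ₀ A𝒫 : ℝ}
    {𝒞 : Matrix (Fin d) (Fin d) ℝ → ℕ → (Fin d → ZMod M) → ℝ} {Mc : ℕ → ℝ}
    {Cα : (Fin d → ℕ) → ℕ → ℝ} {c C : ℝ} {Cℓ : ℕ → ℝ}

set_option maxHeartbeats 3200000 in
/-- **[ABKM19] Lemma 8.4 (`ℓ = 1`), volume-uniform per-polymer form for the step kernels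
`𝒞_{1+q',k+1}`, `𝒞_{1+q,k+1}` of one `TorusFRD` package** (module docstring): for a package with the
regularity gap `d + 1 ≤ 2(ñ−n)` on `(ℤ/L^N)^d`, symmetric `q, q'` in the ball `Σ|q_{ij}| ≤ T₀` (`T₀ ≤ ½`,
`K T₀ ≤ log(1+ρ)`, `ρ < θ̄`), Hölder conjugates `p, q_H` with `p(1+ρ) ≤ 1+ρ''` (`ρ'' < θ̄`), a `k`-polymer
`X` with `k + 1 ≤ N̄ ≤ N` and `diam_∞(X*⁺) ≤ L^{N̄}/2` (`X*⁺ = thicken p_Φ (thicken rad_k X)`), and a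
`T_k^{X*}`-local `C^{r₀}` functional `F` with `‖F‖_{k,X} ≤ b`:
`‖fluct 𝒞_{1+q'} F − fluct 𝒞_{1+q} F‖_{k:k+1,X} ≤ b · ((r₀+1) · 8 q_H · h) · κ^{|X|_k}` with
`h = (3^{d+1} L^{(N̄−(k+1))d})^{1/2} · (T e^{2KT} K)`, `T = Σ|q'−q|`, `κ = A𝒫(ρ'')^{1/p}`.
[cite: Buchholz2016, Thm 4.5] -/
theorem tayNormLE_fluct_sub_fluct_local_of_torusFRD
    (hd : 3 ≤ d) (hMord : 1 ≤ Mord) (hMR : Mord ≤ R) (hLodd : Odd L) (hL : 2 ^ (d + 3) + 16 * R ≤ L)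
    (hM : M = L ^ N)
    (hθbar : 0 < θbar) (hlam : 0 < lam) (hn : 2 * Mord ≤ n) (hn2 : 2 ≤ n) (hnñ : n ≤ ñ)
    (hgap : d + 1 ≤ 2 * (ñ - n))
    (hc : 0 < c) (hC1 : 0 ≤ Cℓ 1)
    (hallA : ∀ A : Matrix (Fin d) (Fin d) ℝ, IsElliptic (1 / 2 : ℝ) 2 A →
        (∀ k, 1 ≤ k → k ≤ N + 1 →
          ∑ x : Fin d → ZMod M, 𝒞 A k x = 0 ∧ ∀ x, 𝒞 A k (-x) = 𝒞 A k x) ∧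
        (∀ k, 1 ≤ k → k ≤ N + 1 → ∀ φ : (Fin d → ZMod M) → ℝ, ∑ x, φ x = 0 →
          0 ≤ ∑ x, ∑ y, φ x * 𝒞 A k (x - y) * φ y) ∧
        (∀ φ : (Fin d → ZMod M) → ℝ, ∑ x, φ x = 0 →
          ellOp A (conv (fun x => ∑ k ∈ Finset.Icc 1 (N + 1), 𝒞 A k x) φ) = φ) ∧
        (∀ k, 1 ≤ k → k ≤ N → Mc k ≤ 0 ∧
          ∀ x : Fin d → ZMod M, ((L : ℝ) ^ k) / 2 ≤ (supNorm x : ℝ) →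
            𝒞 A k x = Mc k) ∧
        (∀ k, 1 ≤ k → k ≤ N + 1 → ∀ B : Matrix (Fin d) (Fin d) ℝ, IsUnitSymm B →
          (∃ ε : ℝ, 0 < ε ∧ ∀ x : Fin d → ZMod M,
            ContDiffOn ℝ ⊤ (fun s : ℝ => 𝒞 (A + s • B) k x) (Set.Ioo (-ε) ε)) ∧
          ∀ α : Fin d → ℕ, ∑ i, α i ≤ n → ∀ ℓ : ℕ, ∀ x : Fin d → ZMod M,
            abs (iteratedDeriv ℓ (fun s : ℝ => iterDiff α (𝒞 (A + s • B) k) x) 0)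
              ≤ Cα α ℓ / (L : ℝ) ^ ((k - 1) * (d - 2 + ∑ i, α i))) ∧
        (∀ k, 1 ≤ k → k ≤ N + 1 → ∀ j : ℕ, ∀ κ : Fin d → ZMod M, κ ≠ 0 → InShell L j κ →
          (j < k →
            c / (L : ℝ) ^ (2 * (d + ñ) + 1) * (L : ℝ) ^ (2 * j)
                / (L : ℝ) ^ ((k - j) * (d - 1 + n)) ≤ (fourierCoeff (𝒞 A k) κ).re ∧
            ‖fourierCoeff (𝒞 A k) κ‖
              ≤ C * (L : ℝ) ^ (2 * (d + ñ) + 1) * (L : ℝ) ^ (2 * j)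
                  / (L : ℝ) ^ ((k - j) * (d - 1 + n))) ∧
          (k ≤ j →
            c / (L : ℝ) ^ (2 * (d + ñ) + 1) * (L : ℝ) ^ (2 * k)
                ≤ (fourierCoeff (𝒞 A k) κ).re ∧
            ‖fourierCoeff (𝒞 A k) κ‖ ≤ C * (L : ℝ) ^ (2 * k)) ∧
          ∀ B : Matrix (Fin d) (Fin d) ℝ, IsUnitSymm B → ∀ ℓ : ℕ, 1 ≤ ℓ →
            (j < k →
              ‖iteratedDeriv ℓ (fun s : ℝ => fourierCoeff (𝒞 (A + s • B) k) κ) 0‖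
                ≤ Cℓ ℓ * (L : ℝ) ^ (2 * (d + ñ) + 1) * (L : ℝ) ^ (2 * j)
                    / (L : ℝ) ^ ((k - j) * (d - 1 + ñ))) ∧
            (k ≤ j →
              ‖iteratedDeriv ℓ (fun s : ℝ => fourierCoeff (𝒞 (A + s • B) k) κ) 0‖
                ≤ Cℓ ℓ * (L : ℝ) ^ (2 * k))))
    (hB : AbkmWeightBounds L N Mord R n θbar lam μ δ₁ δ₀ A𝒫 (fun j => 𝒞 1 j)
      (abkmWeightData L N Mord R θbar (schedDelta δ₀ δ₁ N) fun j => 𝒞 1 j))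
    {k : ℕ} {ρ : ℝ} (hρ0 : 0 ≤ ρ) (hρ : ρ < θbar)
    {T₀ : ℝ} (hT₀ : T₀ ≤ 1 / 2) (hKT₀ : shellRatioConst c (Cℓ 1) (L : ℝ) d ñ * T₀ ≤ Real.log (1 + ρ))
    {q q' : Matrix (Fin d) (Fin d) ℝ} (hq : q.IsSymm) (hq' : q'.IsSymm)
    (hqT : ∑ i, ∑ j, |q i j| ≤ T₀) (hq'T : ∑ i, ∑ j, |q' i j| ≤ T₀)
    {p qH ρ'' : ℝ} (hpq : p.HolderConjugate qH) (hρ''0 : 0 ≤ ρ'') (hρ'' : ρ'' < θbar)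
    (hpρ : p * (1 + ρ) ≤ 1 + ρ'')
    {pT r₀ : ℕ} {h A : ℝ} {X : Finset (Fin d → ZMod M)} (hX : IsPolymer (L ^ k) X)
    -- the small torus: `k + 1 ≤ N̄ ≤ N`, `X*⁺` has sup-diameter `≤ L^{N̄}/2`
    {Nb : ℕ} (hNbk : k + 1 ≤ Nb) (hNbN : Nb ≤ N)
    (hdiam : ∀ x ∈ thicken pT (thicken (starRad R L d k) X), ∀ y ∈ thicken pT (thicken (starRad R L d k) X),
      supNorm (x - y) ≤ L ^ Nb / 2)
    {F : ((Fin d → ZMod M) → ℝ) → ℂ} {b : ℝ} (hb : 0 ≤ b) (hFd : ContDiff ℝ r₀ F)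
    (hFloc : IsGaugeLocal ((abkmNormParams L N Mord R pT r₀ h θbar A (schedDelta δ₀ δ₁ N)
      fun j => 𝒞 1 j).gauge k X) F)
    (hF : TayNormLE ((abkmNormParams L N Mord R pT r₀ h θbar A (schedDelta δ₀ δ₁ N) fun j => 𝒞 1 j).gauge k X)
      r₀ ((abkmWeightData L N Mord R θbar (schedDelta δ₀ δ₁ N) fun j => 𝒞 1 j).weight k X) F b) :
    TayNormLE ((abkmNormParams L N Mord R pT r₀ h θbar A (schedDelta δ₀ δ₁ N) fun j => 𝒞 1 j).gauge k X) r₀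
      ((abkmWeightData L N Mord R θbar (schedDelta δ₀ δ₁ N) fun j => 𝒞 1 j).midWeight k X)
      (fluct (𝒞 ((1 : Matrix (Fin d) (Fin d) ℝ) + q') (k + 1)) F -
        fluct (𝒞 ((1 : Matrix (Fin d) (Fin d) ℝ) + q) (k + 1)) F)
      (b * ((r₀ + 1) * (8 * qH *
          (Real.sqrt ((3 : ℝ) ^ (d + 1) * (L : ℝ) ^ ((Nb - (k + 1)) * d)) *
            ((∑ i, ∑ j, |(q' - q) i j|) *
              Real.exp (2 * shellRatioConst c (Cℓ 1) (L : ℝ) d ñ * ∑ i, ∑ j, |(q' - q) i j|) *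
              shellRatioConst c (Cℓ 1) (L : ℝ) d ñ)))) *
        (weightIntConstRho θbar ρ'' (traceConst d Mord R lam (derivSum d n fun θ' _ => Cα θ' 0)) ^ (1 / p)) ^
          numBlocks (L ^ k) X) := by
  have hk : k + 1 ≤ N + 1 := by omega
  have hkN : k + 1 ≤ N := le_trans hNbk hNbN
  have h8 : 8 ≤ 2 ^ (d + 3) := by
    calc 8 = 2 ^ 3 := by norm_num
      _ ≤ 2 ^ (d + 3) := Nat.pow_le_pow_right (by norm_num) (by omega)
  have hL2 : 2 ≤ L := by omega
  have hL5 : 5 ≤ L := by omega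
  have hL1 : 1 ≤ L := by omega
  have hd1 : 1 ≤ d := by omega
  have hL0 : (0 : ℝ) ≤ (L : ℝ) := Nat.cast_nonneg _
  have hL1r : (1 : ℝ) ≤ (L : ℝ) := by exact_mod_cast hL1
  have hLpos : (0 : ℝ) < (L : ℝ) := by linarith
  have hp0 : 0 ≤ p := by linarith [hpq.lt]
  have hq2 : ∑ i, ∑ j, |q i j| ≤ 1 / 2 := hqT.trans hT₀
  have hq'2 : ∑ i, ∑ j, |q' i j| ≤ 1 / 2 := hq'T.trans hT₀
  have hellq : IsElliptic (1 / 2 : ℝ) 2 ((1 : Matrix (Fin d) (Fin d) ℝ) + q) :=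
    isElliptic_one_add_of_entrySum_le hq hq2
  have hellq' : IsElliptic (1 / 2 : ℝ) 2 ((1 : Matrix (Fin d) (Fin d) ℝ) + q') :=
    isElliptic_one_add_of_entrySum_le hq' hq'2
  -- the small torus `(ℤ/L^N̄)^d`
  set Mb : ℕ := L ^ Nb with hMbdef
  haveI : NeZero Mb := ⟨pow_ne_zero _ (by omega)⟩
  set r : ℕ := L ^ (N - Nb) with hrdef
  have hr1 : 1 ≤ r := Nat.one_le_pow _ _ (by omega)
  have hMr : M = r * Mb := by
    rw [hM, hrdef, hMbdef, ← pow_add, Nat.sub_add_cancel hNbN]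
  have hMbodd : Odd Mb := by rw [hMbdef]; exact hLodd.pow
  have hdvd : Mb ∣ M := ⟨r, by rw [hMr, mul_comm]⟩
  have hMble : Mb ≤ M := Nat.le_of_dvd (Nat.pos_of_ne_zero (NeZero.ne M)) hdvd
  -- constants
  set K := shellRatioConst c (Cℓ 1) (L : ℝ) d ñ with hKdef
  have hK0 : 0 ≤ K := shellRatioConst_nonneg hc hC1 hL0 d ñ
  set T := ∑ i, ∑ j, |(q' - q) i j| with hTdef
  have hT0 : 0 ≤ T := sum_nonneg fun _ _ => sum_nonneg fun _ _ => abs_nonneg _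
  set E := T * Real.exp (2 * K * T) with hEdef
  have hE0 : 0 ≤ E := by positivity
  set Kj : ℕ → ℝ := fun j => K / (L : ℝ) ^ ((k + 1 - j) * (ñ - n)) with hKjdef
  have hKj0 : ∀ j, 0 ≤ Kj j := fun j => by positivity
  have hKjle : ∀ j, Kj j ≤ K := fun j => div_le_self hK0 (one_le_pow₀ hL1r)
  -- big-torus kernel data
  set 𝒞a : (Fin d → ZMod M) → ℝ := 𝒞 ((1 : Matrix (Fin d) (Fin d) ℝ) + q') (k + 1) with h𝒞a
  set 𝒞b : (Fin d → ZMod M) → ℝ := 𝒞 ((1 : Matrix (Fin d) (Fin d) ℝ) + q) (k + 1) with h𝒞b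
  have hSa := stepKernelBounds_one_add_of_torusFRD hd hMord hMR hLodd hL hθbar hlam hn hn2 hnñ hc hC1 hallA hB hk
    hρ0 hρ hT₀ hKT₀ hq' hq'T
  have hSb := stepKernelBounds_one_add_of_torusFRD hd hMord hMR hLodd hL hθbar hlam hn hn2 hnñ hc hC1 hallA hB hk
    hρ0 hρ hT₀ hKT₀ hq hqT
  have hSp : ∀ t ∈ Set.Icc (0 : ℝ) 1,
      StepKernelBounds (abkmWeightData L N Mord R θbar (schedDelta δ₀ δ₁ N) fun j => 𝒞 1 j) L k
        (weightIntConstRho θbar ρ'' (traceConst d Mord R lam (derivSum d n fun θ' _ => Cα θ' 0)))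
        (p * secondDiffConst fun θ' => Cα θ' 0)
        (fun x => p * (𝒞b x + t * (𝒞a x - 𝒞b x))) := fun t ht =>
    stepKernelBounds_const_mul_kernelSeg_of_torusFRD hd hMord hMR hLodd hL hθbar hlam hn hn2 hnñ hc hC1 hallA hB
      hk hρ0 hT₀ hKT₀ hq hq' hqT hq'T hp0 hρ''0 hρ'' hpρ ht.1 ht.2
  have hA𝒫p : 0 ≤ weightIntConstRho θbar ρ'' (traceConst d Mord R lam (derivSum d n fun θ' _ => Cα θ' 0)) :=
    zero_le_one.trans (one_le_weightIntConstRho hθbar hρ''0 hρ''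
      (traceConst_nonneg d Mord R hlam.le (derivSum_nonneg d n _)))
  have hoa := (hallA _ hellq').1 (k + 1) (by omega) hk
  have hob := (hallA _ hellq).1 (k + 1) (by omega) hk
  have hposa : ∀ κ : Fin d → ZMod M, κ ≠ 0 → 0 < (fourierCoeff 𝒞a κ).re := fun κ hκ =>
    re_fourierCoeff_pos_of_torusFRD (hallA _ hellq').2.2.2.2.2 hc hL2 (by omega) hk hκ
  have hposb : ∀ κ : Fin d → ZMod M, κ ≠ 0 → 0 < (fourierCoeff 𝒞b κ).re := fun κ hκ =>
    re_fourierCoeff_pos_of_torusFRD (hallA _ hellq).2.2.2.2.2 hc hL2 (by omega) hk hκ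
  -- finite range: both kernels are the constant `M_{k+1}` beyond sup-norm `L^{N̄}/2`
  have hfin := fun (A' : Matrix (Fin d) (Fin d) ℝ) (hA' : IsElliptic (1 / 2 : ℝ) 2 A') =>
    (hallA A' hA').2.2.2.1 (k + 1) (by omega) hkN
  have hMc : Mc (k + 1) ≤ 0 := (hfin _ hellq).1
  have hfar : ∀ (A' : Matrix (Fin d) (Fin d) ℝ), IsElliptic (1 / 2 : ℝ) 2 A' →
      ∀ x : Fin d → ZMod M, Mb / 2 < supNorm x → 𝒞 A' (k + 1) x = Mc (k + 1) := by
    intro A' hA' x hx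
    refine (hfin A' hA').2 x ?_
    have h1 : (L : ℝ) ^ (k + 1) ≤ (L : ℝ) ^ Nb := pow_le_pow_right₀ hL1r hNbk
    have h2 : ((Mb / 2 : ℕ) : ℝ) + 1 ≤ (supNorm x : ℝ) := by exact_mod_cast hx
    have h3 : ((L : ℝ) ^ Nb) / 2 ≤ ((Mb / 2 : ℕ) : ℝ) + 1 := by
      have : ((Mb / 2 : ℕ) : ℝ) ≥ (Mb : ℝ) / 2 - 1 := by
        have h4 : (Mb : ℝ) ≤ 2 * ((Mb / 2 : ℕ) : ℝ) + 1 := by exact_mod_cast (by omega : Mb ≤ 2 * (Mb / 2) + 1)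
        linarith
      have hMbr : (Mb : ℝ) = (L : ℝ) ^ Nb := by rw [hMbdef]; push_cast; rfl
      linarith
    linarith
  -- the re-periodised kernels on the small torus
  set 𝒞a' : (Fin d → ZMod Mb) → ℝ := fun z => 𝒞a (liftSite M z) with h𝒞a'
  set 𝒞b' : (Fin d → ZMod Mb) → ℝ := fun z => 𝒞b (liftSite M z) with h𝒞b'
  have hea' : ∀ z, 𝒞a' (-z) = 𝒞a' z := fun z => comp_liftSite_even hMbodd hoa.2 z
  have heb' : ∀ z, 𝒞b' (-z) = 𝒞b' z := fun z => comp_liftSite_even hMbodd hob.2 z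
  have hfa_ne : ∀ κ : Fin d → ZMod Mb, κ ≠ 0 → fourierCoeff 𝒞a' κ = fourierCoeff 𝒞a (liftMode M r κ) :=
    fun κ hκ => fourierCoeff_comp_liftSite_of_ne_zero hr1 hMr hMbodd (hfar _ hellq') hκ
  have hfb_ne : ∀ κ : Fin d → ZMod Mb, κ ≠ 0 → fourierCoeff 𝒞b' κ = fourierCoeff 𝒞b (liftMode M r κ) :=
    fun κ hκ => fourierCoeff_comp_liftSite_of_ne_zero hr1 hMr hMbodd (hfar _ hellq) hκ
  have hfa_zero : (fourierCoeff 𝒞a' 0).re = -(Mc (k + 1)) * ((M : ℝ) ^ d - (Mb : ℝ) ^ d) := by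
    have h := fourierCoeff_comp_liftSite_zero hr1 hMr hMbodd (hfar _ hellq') (𝒞 := 𝒞a)
    have h2 : fourierCoeff 𝒞a' 0 = ((-(Mc (k + 1)) * ((M : ℝ) ^ d - (Mb : ℝ) ^ d) : ℝ) : ℂ) := by
      rw [h, fourierCoeff_zero, hoa.1]; push_cast; ring
    rw [h2, Complex.ofReal_re]
  have hfb_zero : (fourierCoeff 𝒞b' 0).re = -(Mc (k + 1)) * ((M : ℝ) ^ d - (Mb : ℝ) ^ d) := by
    have h := fourierCoeff_comp_liftSite_zero hr1 hMr hMbodd (hfar _ hellq) (𝒞 := 𝒞b)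
    have h2 : fourierCoeff 𝒞b' 0 = ((-(Mc (k + 1)) * ((M : ℝ) ^ d - (Mb : ℝ) ^ d) : ℝ) : ℂ) := by
      rw [h, fourierCoeff_zero, hob.1]; push_cast; ring
    rw [h2, Complex.ofReal_re]
  have hzero_nn : 0 ≤ -(Mc (k + 1)) * ((M : ℝ) ^ d - (Mb : ℝ) ^ d) := by
    refine mul_nonneg (by linarith) ?_
    have : (Mb : ℝ) ^ d ≤ (M : ℝ) ^ d := pow_le_pow_left₀ (Nat.cast_nonneg _) (by exact_mod_cast hMble) d
    linarith
  have hposa' : ∀ κ : Fin d → ZMod Mb, κ ≠ 0 → 0 < (fourierCoeff 𝒞a' κ).re := by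
    intro κ hκ
    rw [hfa_ne κ hκ]
    exact hposa _ (fun h0 => hκ ((liftMode_eq_zero_iff hr1 hMr κ).1 h0))
  have hposb' : ∀ κ : Fin d → ZMod Mb, κ ≠ 0 → 0 < (fourierCoeff 𝒞b' κ).re := by
    intro κ hκ
    rw [hfb_ne κ hκ]
    exact hposb _ (fun h0 => hκ ((liftMode_eq_zero_iff hr1 hMr κ).1 h0))
  have hnna' : ∀ κ : Fin d → ZMod Mb, 0 ≤ (fourierCoeff 𝒞a' κ).re := by
    intro κ
    by_cases hκ : κ = 0
    · rw [hκ, hfa_zero]; exact hzero_nn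
    · exact (hposa' κ hκ).le
  have hnnb' : ∀ κ : Fin d → ZMod Mb, 0 ≤ (fourierCoeff 𝒞b' κ).re := by
    intro κ
    by_cases hκ : κ = 0
    · rw [hκ, hfb_zero]; exact hzero_nn
    · exact (hposb' κ hκ).le
  -- the support of the gauge and the covariance identity
  set S := thicken pT (thicken (starRad R L d k) X) with hSdef
  have hcova : ∀ x ∈ S, ∀ y ∈ S, 𝒞a' (projSite hdvd x - projSite hdvd y) = 𝒞a (x - y) :=
    fun x hx y hy => comp_liftSite_projSite_sub hdvd hMbodd 𝒞a (hdiam x hx y hy)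
  have hcovb : ∀ x ∈ S, ∀ y ∈ S, 𝒞b' (projSite hdvd x - projSite hdvd y) = 𝒞b (x - y) :=
    fun x hx y hy => comp_liftSite_projSite_sub hdvd hMbodd 𝒞b (hdiam x hx y hy)
  have hTloc : ∀ ζ ζ' : (Fin d → ZMod M) → ℝ, (∀ x ∈ S, ζ x = ζ' x) →
      (abkmNormParams L N Mord R pT r₀ h θbar A (schedDelta δ₀ δ₁ N) fun j => 𝒞 1 j).gauge k X ζ =
        (abkmNormParams L N Mord R pT r₀ h θbar A (schedDelta δ₀ δ₁ N) fun j => 𝒞 1 j).gauge k X ζ' :=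
    fun ζ ζ' hζ => fieldGauge_eq_of_eqOn_thicken hζ
  -- the mode-wise relative bound on the small torus
  classical
  set ρm : (Fin d → ZMod Mb) → ℝ := fun κ =>
    if hκ : κ = 0 then 0 else
      Kj (Classical.choose (exists_inShell hL2 hκ)) * T *
        Real.exp (2 * (Kj (Classical.choose (exists_inShell hL2 hκ)) * T)) with hρmdef
  have hρm_nonneg : ∀ κ, 0 ≤ ρm κ := by
    intro κ
    simp only [hρmdef]
    split_ifs
    · exact le_rfl
    · exact mul_nonneg (mul_nonneg (hKj0 _) hT0) (Real.exp_pos _).le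
  have hρm0 : ρm 0 = 0 := by simp only [hρmdef, dif_pos]
  have hshell : ∀ (κ : Fin d → ZMod Mb) (hκ : κ ≠ 0),
      |(fourierCoeff 𝒞a' κ).re - (fourierCoeff 𝒞b' κ).re| ≤ ρm κ * (fourierCoeff 𝒞a' κ).re ∧
        |(fourierCoeff 𝒞a' κ).re - (fourierCoeff 𝒞b' κ).re| ≤ ρm κ * (fourierCoeff 𝒞b' κ).re := by
    intro κ hκ
    have hj := Classical.choose_spec (exists_inShell hL2 hκ)
    have hj' : InShell L (Classical.choose (exists_inShell hL2 hκ)) (liftMode M r κ) :=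
      (inShell_liftMode_iff hr1 hMr L _ κ).2 hj
    have hκ' : liftMode M r κ ≠ 0 := fun h0 => hκ ((liftMode_eq_zero_iff hr1 hMr κ).1 h0)
    have hcmp := abs_re_fourierCoeff_one_add_sub_le_shell_of_torusFRD (fun A hA => (hallA A hA).2.2.2.2.1)
      (fun A hA => (hallA A hA).2.2.2.2.2) hc hC1 hL2 hnñ hq hq' hq2 hq'2 (k := k + 1) (by omega) hk hκ' hj'
    have hρκ : ρm κ = Kj (Classical.choose (exists_inShell hL2 hκ)) * T *
        Real.exp (2 * (Kj (Classical.choose (exists_inShell hL2 hκ)) * T)) := by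
      simp only [hρmdef, dif_neg hκ]
    rw [hρκ, hfa_ne κ hκ, hfb_ne κ hκ]
    exact hcmp
  have hcmpa : ∀ κ : Fin d → ZMod Mb,
      |(fourierCoeff 𝒞a' κ).re - (fourierCoeff 𝒞b' κ).re| ≤ ρm κ * (fourierCoeff 𝒞a' κ).re := by
    intro κ
    by_cases hκ : κ = 0
    · rw [hκ, hfa_zero, hfb_zero, sub_self, abs_zero, hρm0, zero_mul]
    · exact (hshell κ hκ).1
  have hcmpb : ∀ κ : Fin d → ZMod Mb,
      |(fourierCoeff 𝒞a' κ).re - (fourierCoeff 𝒞b' κ).re| ≤ ρm κ * (fourierCoeff 𝒞b' κ).re := by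
    intro κ
    by_cases hκ : κ = 0
    · rw [hκ, hfa_zero, hfb_zero, sub_self, abs_zero, hρm0, zero_mul]
    · exact (hshell κ hκ).2
  -- the Hilbert–Schmidt sum over the shells OF THE SMALL TORUS
  have hρm_shell : ∀ κ : Fin d → ZMod Mb, κ ≠ 0 →
      ∃ j, InShell L j κ ∧ |ρm κ| ≤ E * (K / (L : ℝ) ^ ((k + 1 - j) * (ñ - n))) := by
    intro κ hκ
    refine ⟨Classical.choose (exists_inShell hL2 hκ), Classical.choose_spec (exists_inShell hL2 hκ), ?_⟩
    set j := Classical.choose (exists_inShell hL2 hκ) with hjdef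
    rw [abs_of_nonneg (hρm_nonneg κ)]
    have hρκ : ρm κ = Kj j * T * Real.exp (2 * (Kj j * T)) := by simp only [hρmdef, dif_neg hκ, hjdef]
    rw [hρκ]
    have hexp : Real.exp (2 * (Kj j * T)) ≤ Real.exp (2 * K * T) := by
      refine Real.exp_le_exp.2 ?_
      have := mul_le_mul_of_nonneg_right (hKjle j) hT0
      linarith
    calc Kj j * T * Real.exp (2 * (Kj j * T)) ≤ Kj j * T * Real.exp (2 * K * T) :=
          mul_le_mul_of_nonneg_left hexp (mul_nonneg (hKj0 j) hT0)
      _ = E * Kj j := by rw [hEdef]; ring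
      _ = E * (K / (L : ℝ) ^ ((k + 1 - j) * (ñ - n))) := by rw [hKjdef]
  have hsum := sum_sq_le_of_shellRatio (d := d) (M := Mb) hL5 hMbdef (k := k + 1) hd1 hgap (E := E) (K := K)
    hρm0 hρm_shell
  set hS := Real.sqrt ((3 : ℝ) ^ (d + 1) * (L : ℝ) ^ ((Nb - (k + 1)) * d)) * (E * K) with hhSdef
  have hhS0 : 0 ≤ hS := by positivity
  have hsum' : ∑ κ, ρm κ ^ 2 ≤ hS ^ 2 := by
    rw [hhSdef, mul_pow, Real.sq_sqrt (by positivity)]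
    calc ∑ κ, ρm κ ^ 2 ≤ (3 : ℝ) ^ (d + 1) * (E * K) ^ 2 * (L : ℝ) ^ ((Nb - (k + 1)) * d) := hsum
      _ = (3 : ℝ) ^ (d + 1) * (L : ℝ) ^ ((Nb - (k + 1)) * d) * (E * K) ^ 2 := by ring
  -- the localisation engine
  have hmain := tayNormLE_fluct_sub_fluct_of_sum_sq_transfer _ hB.isLocal hB.dominated hSa hSb hpq hSp hoa.2 hob.2
    hoa.1 hob.1 hposa hposb (projSite hdvd) S hea' heb' hnna' hnnb' hposa' hposb' hcova hcovb hρm_nonneg hcmpa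
    hcmpb hhS0 hsum' hX _ (gauge_const _ k X) hTloc hb hFd hFloc hF
  rw [pow_rpow_inv_eq_rpow_inv_pow hA𝒫p] at hmain
  convert hmain using 1
  rw [hhSdef, hEdef]
  ring

end Package

end Literature.MathematicalPhysics.StatisticalMechanics.GradientRG

end
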